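/-
Copyright (c) 2026 the pub-hodgecm-mathlib formalisation cell (harness21).  Prover seat hodgecm-mathlib-K2E1-p11 (g2), Track B ∕ K2-LIT, h413 =
`stmt-HodgeConjecture-24833`, line `K2_E1_TraceFormulaBeta`, 5Res campaign «ENDGAME BY FAMILIES» ∕ ROADCARD §3′ M2 v2 «SPECTRAL-MEASURE EXHAUSTION» (K2E1-plan (g7) (181)), deal D4′a
(ruling (213) «=» option (α)): the t-CONVOLUTION DEVICE of §3′.1 (i) — right smoothing commutes with convolution along a torus family (bare Fubini, any topological group), the radial
multiplicative convolution `k ⋆ f` and its MELLIN MULTIPLIER `k̂(w) = ∫ k(s)·s^{−w} dσ(s)`, the WEYL-SYMMETRIC class, and the axis model identity `U_{k⋆f} = k̂(½+it)·U_f` of ★ P2's model.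
-/
import Summits.HodgeConjecture.HodgeConjecture.Theorems.K2E1PseudoEisensteinHeckeIntertwiningCMTwo   -- ★ P3b FILE 2 p860039 (this seat): the `(μ, h, H)` edition whose proofs §2 mirrors with `(σ, k, s)`; brings ★ D0 `exists_one_le_forall_eq_zero`, `Mathlib.Analysis.MellinTransform`
import HarnessLib

/-!
# D4′a — `K2E1TorusConvolutionCommuteU`: the t-convolution device of ROADCARD §3′.1 (i) — smoothing∕torus-convolution commutation, the radial multiplicative convolution `k ⋆ f`, its Mellin
# multiplier, the Weyl-symmetric class, and `U_{k⋆f} = k̂(½+it)·U_f`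

Cell `pub/hodgecm-mathlib`, crux H413 = `stmt-HodgeConjecture-24833`, route `HCCMUnconditional`; dealer K2E1-plan (g7) ROADCARD §3′.2 D4′a, rulings (181)∕(190)∕(213) (this seat's finding
«the device needs the WEYL-SYMMETRIC class» ACCEPTED and §3′.1 (i) amended of record).  THEOREMS ONLY (no `def` ∕ `instance` ∕ `notation` ∕ named-fact hypothesis ∕ `sorry`; default heartbeats;
`(k ⋆ f)(r) := ∫ f(r·s)·k(s) dσ(s)` and `k̂(w) := ∫ k(s)·s^{w} dσ(s)` are SPELLED INLINE); lane `--kind proof --supports stmt-HodgeConjecture-24833 --as helper` (count-neutral; closes no socket).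
THE MATHEMATICS ([MoeglinWaldspurger1995, II.1.1–II.1.4, II.2.4]; [Langlands1976, §6]; [Titchmarsh1948, §1.29]; [Folland1999, Thm. 2.37]).
(1) SMOOTHING COMMUTES WITH TORUS CONVOLUTION (§1, ANY topological group `G`, any finite-on-compacts s-finite `ν` on `G` and `σ` on `ℝ`, any continuous family `a : ℝ → G`): for `η ∈ C_c(G)`,
`k ∈ C_c(ℝ)`, `Φ ∈ C(G)`: `∫ η(g)·(∫ k(s)Φ(g⁻¹·x·a_s) dσ) dν = ∫ k(s)·(∫ η(g)Φ(g⁻¹·(x·a_s)) dν) dσ` — in ★ F2a's right-currency (`Φ^η(h) = ∫ η(g)Φ(g⁻¹h) dν`, K2E1-p10 p860012) this reads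
**`(k ⋆ Φ)^η = k ⋆ (Φ^η)`**: left smoothing by `g⁻¹` and right translation by the torus act on opposite sides, so the claim is bare Fubini on `tsupport η × tsupport k` (ROADCARD §3′.4).
(2) THE RADIAL MULTIPLICATIVE CONVOLUTION (§2, `σ` any finite-on-compacts s-finite measure on `ℝ`, `k ∈ C_c((0,∞))`, `f ∈ C_c((0,∞))`): `(k ⋆ f)(r) := ∫ f(r·s)k(s) dσ(s)` is again in `C_c((0,∞))`,
`C^n` when `f` is, and **`mellin (k ⋆ f) w = k̂(−w)·mellin f w`**, `k̂(w) := ∫ k(s)·s^{w} dσ(s)` (Fubini + Mathlib `mellin_comp_mul_right`) — the `(σ, k, s)` mirror of ★ P3b FILE 2's `(μ, h, H(y))` proofs;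
under a torus letter `H(g·a_s) = H(g)·s` the group-side convolution of a radial `Φ = f∘H` is `(k ⋆ f)∘H` (`torusConv_comp_eq`).
(3) THE AXIS (§3): in ★ P2's model `U_f(t) = f̃(½+it) + cI(½−it)·f̃(½−it)` (`f̃(z) = mellin f (−z)`) one gets `U_{k⋆f}(t) = k̂(½+it)·f̃(½+it) + cI(½−it)·k̂(½−it)·f̃(½−it)`, which is
`k̂(½+it)·U_f(t)` for all `f` IFF **`k̂(½−it) = k̂(½+it)`** (the WEYL SYMMETRY `k̂(z) = k̂(1−z)` — automatic for spherical Hecke kernels by ★ (G1), to be IMPOSED on `k` here): HEAD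
**`axisModel_mulConv_eq_mul`** with the symmetry as the hypothesis `hW` on the `σ`-multiplier; for `σ = d×s` (so `k̂ = mellin k`) it is discharged by **`mellin_eq_mellin_one_sub`**:
`k(s⁻¹) = s·k(s)` for `s > 0` (e.g. `k(s) = s^{−1/2}κ(log s)`, `κ ∈ C_c^∞(ℝ)` even; then `k̂(½+it) = κ̂(t)` is real and even and these separate the points of the half-axis `t ≥ 0`) ⟹
`mellin k z = mellin k (1 − z)` (Mathlib `mellin_comp_inv`, `mellin_cpow_smul`).  [The mirror convention `(k ⋆′ f)(r) = ∫ f(r∕s)k(s) d×s` has multiplier `mellin k (−z)` and symmetric class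
`k(s⁻¹) = s⁻¹·k(s)` — the form quoted on the bus at 12:13Z; the two classes correspond under `k(s) ↦ k(s⁻¹)`.]
* §1 **`integral_mul_torusConv_smoothed_comm`**.  * §2 `exists_bounds_of_tsupport_subset_Ioi`, `mulConv_integrand_eq_zero`, `mulConv_eq_zero`, **`hasCompactSupport_mulConv`**, **`tsupport_mulConv_subset_Ioi`**,
  **`continuous_mulConv`**, `hasDerivAt_mulConv`, **`contDiff_mulConv`**, **`mellin_mulConv`**, `torusConv_comp_eq`.  * §3 **`mellin_eq_mellin_one_sub`**, **`axisModel_mulConv_eq_mul`**.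
HONEST LABEL.  Count-neutral helper; proves no printed statement; letter-free; clause (c) of D4′a for GENERAL section fields `Ψ` waits for D4′c's `U` (K2E4-p10 (g7)); the L²-operator reading
is ★ F2a.  HC_CM is proved only modulo the 7 printed citations (2 remaining named inputs: hLiu418 = `stmt-HodgeConjecture-24832`, h413 = `stmt-HodgeConjecture-24833`) until rung 0 closes.

## References
* [MoeglinWaldspurger1995] C. Mœglin, J.-L. Waldspurger, *Spectral decomposition and Eisenstein series* (1995), II.1.1–II.1.4, II.2.4.
* [Langlands1976] R. P. Langlands, *On the Functional Equations Satisfied by Eisenstein Series*, LNM 544 (1976), §6.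
* [Titchmarsh1948] E. C. Titchmarsh, *Introduction to the Theory of Fourier Integrals* (1948), §1.29 (Mellin convolution).
* [Folland1999] G. B. Folland, *Real Analysis* (2nd ed., 1999), Thm. 2.37 (Fubini–Tonelli), Thm. 2.27 (differentiation under the integral).
-/

set_option autoImplicit false
-- the mandated namespace repeats `HodgeConjecture.HodgeConjecture`, as in every `Theorems/*.lean` of this sub-problem
set_option linter.dupNamespace false

noncomputable section

open MeasureTheory MeasureTheory.Measure Set Filter Topology Complex
open scoped NNReal ENNReal
open Summit.HodgeConjecture.HodgeConjecture.Cruxes.H413.K2E1PseudoEisensteinRadialCMTwo (exists_one_le_forall_eq_zero)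

namespace Summit.HodgeConjecture.HodgeConjecture.Cruxes.H413.K2E1TorusConvolutionCommuteU

/-! ## §1 Smoothing commutes with torus convolution (bare Fubini, any topological group) -/

section Fubini

variable {G : Type*} [Group G] [TopologicalSpace G] [IsTopologicalGroup G] [MeasurableSpace G] [BorelSpace G]

/-- **`(k ⋆ Φ)^η = k ⋆ (Φ^η)` — RIGHT SMOOTHING COMMUTES WITH CONVOLUTION ALONG A TORUS FAMILY.**  For a topological group `G`, measures `ν` on `G` and `σ` on `ℝ` finite on compacta and
s-finite, `η ∈ C_c(G)`, `k ∈ C_c(ℝ)`, a continuous family `a : ℝ → G`, a continuous `Φ : G → ℂ` and `x ∈ G`: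
`∫ η(g)·(∫ k(s)·Φ(g⁻¹·x·a_s) dσ(s)) dν(g) = ∫ k(s)·(∫ η(g)·Φ(g⁻¹·(x·a_s)) dν(g)) dσ(s)` — the integrand `η(g)k(s)Φ(g⁻¹xa_s)` is continuous with support in `tsupport η × tsupport k`.
[cite: MoeglinWaldspurger1995, II.1.1–II.1.3] [cite: Folland1999, Thm. 2.37] -/
theorem integral_mul_torusConv_smoothed_comm (ν : Measure G) [SFinite ν] [IsFiniteMeasureOnCompacts ν] (σ : Measure ℝ) [SFinite σ] [IsFiniteMeasureOnCompacts σ]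
    {η : G → ℂ} (hη : Continuous η) (hηs : HasCompactSupport η) {k : ℝ → ℂ} (hk : Continuous k) (hks : HasCompactSupport k)
    {a : ℝ → G} (ha : Continuous a) {Φ : G → ℂ} (hΦ : Continuous Φ) (x : G) :
    ∫ g, η g * (∫ s, k s * Φ (g⁻¹ * x * a s) ∂σ) ∂ν = ∫ s, k s * (∫ g, η g * Φ (g⁻¹ * (x * a s)) ∂ν) ∂σ := by
  set F : G → ℝ → ℂ := fun g s => η g * (k s * Φ (g⁻¹ * x * a s)) with hF
  have hc : Continuous (Function.uncurry F) :=
    (hη.comp continuous_fst).mul ((hk.comp continuous_snd).mul (hΦ.comp (((continuous_fst.inv).mul continuous_const).mul (ha.comp continuous_snd))))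
  have hs : HasCompactSupport (Function.uncurry F) := by
    refine HasCompactSupport.intro (hηs.isCompact.prod hks.isCompact) ?_
    rintro ⟨g, s⟩ hgs
    rw [Set.mem_prod, not_and_or] at hgs
    rcases hgs with hg | hs'
    · simp only [Function.uncurry_apply_pair, hF, image_eq_zero_of_notMem_tsupport hg, zero_mul]
    · simp only [Function.uncurry_apply_pair, hF, image_eq_zero_of_notMem_tsupport hs', zero_mul, mul_zero]
  have hint : Integrable (Function.uncurry F) (ν.prod σ) := hc.integrable_of_hasCompactSupport hs
  calc ∫ g, η g * (∫ s, k s * Φ (g⁻¹ * x * a s) ∂σ) ∂ν = ∫ g, ∫ s, F g s ∂σ ∂ν :=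
        integral_congr_ae (Eventually.of_forall fun g => by simp only [hF, ← integral_const_mul])
    _ = ∫ s, ∫ g, F g s ∂ν ∂σ := integral_integral_swap hint
    _ = ∫ s, k s * (∫ g, η g * Φ (g⁻¹ * (x * a s)) ∂ν) ∂σ := by
        refine integral_congr_ae (Eventually.of_forall fun s => ?_)
        show ∫ g, F g s ∂ν = k s * ∫ g, η g * Φ (g⁻¹ * (x * a s)) ∂ν
        rw [← integral_const_mul]
        refine integral_congr_ae (Eventually.of_forall fun g => ?_)
        show F g s = k s * (η g * Φ (g⁻¹ * (x * a s)))
        simp only [hF, mul_assoc]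
        ring

end Fubini

/-! ## §2 The radial multiplicative convolution `(k ⋆ f)(r) = ∫ f(r·s) k(s) dσ(s)` on `(0,∞)` -/

section Radial

/-- **A PROFILE WITH COMPACT SUPPORT IN `(0,∞)` LIVES IN SOME `[c₁, c₂]`, `c₁ > 0`**: `k(s) ≠ 0 ⟹ c₁ ≤ s ≤ c₂` (★ D0 `exists_one_le_forall_eq_zero`: `k = 0` off `(T⁻¹, T)`). [folklore] -/
theorem exists_bounds_of_tsupport_subset_Ioi {k : ℝ → ℂ} (hks : HasCompactSupport k) (hk0 : tsupport k ⊆ Ioi 0) :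
    ∃ c₁ c₂ : ℝ, 0 < c₁ ∧ c₁ ≤ c₂ ∧ ∀ s : ℝ, k s ≠ 0 → c₁ ≤ s ∧ s ≤ c₂ := by
  obtain ⟨T, hT, hhi, hlo⟩ := exists_one_le_forall_eq_zero hks hk0
  have hT0 : 0 < (T : ℝ) := one_pos.trans_le (by exact_mod_cast hT)
  have hT1 : (1 : ℝ) ≤ T := by exact_mod_cast hT
  refine ⟨(T : ℝ)⁻¹, T, inv_pos.2 hT0, (inv_le_one_of_one_le₀ hT1).trans hT1, fun s hs => ⟨?_, ?_⟩⟩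
  · by_contra h
    exact hs (hlo s (not_le.1 h))
  · by_contra h
    exact hs (hhi s (not_le.1 h))

/-- The integrand `f(r·s)·k(s)` vanishes for every `s` as soon as `r < T⁻¹∕c₂` or `T∕c₁ < r` (`f = 0` off `(T⁻¹, T)`, `c₁ ≤ s ≤ c₂` on `{k ≠ 0}`). [folklore] -/
theorem mulConv_integrand_eq_zero {k : ℝ → ℂ} {f : ℝ → ℂ} {T : ℝ≥0} (hT : 1 ≤ T) (hhi : ∀ r : ℝ, (T : ℝ) < r → f r = 0) (hlo : ∀ r : ℝ, r < (T : ℝ)⁻¹ → f r = 0)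
    {c₁ c₂ : ℝ} (hc₁ : 0 < c₁) (hc₁₂ : c₁ ≤ c₂) (hk : ∀ s : ℝ, k s ≠ 0 → c₁ ≤ s ∧ s ≤ c₂)
    {r : ℝ} (hr : r < (T : ℝ)⁻¹ / c₂ ∨ (T : ℝ) / c₁ < r) (s : ℝ) : f (r * s) * k s = 0 := by
  by_cases hs : k s = 0
  · rw [hs, mul_zero]
  obtain ⟨h₁, h₂⟩ := hk s hs
  have hc₂ : 0 < c₂ := hc₁.trans_le hc₁₂
  have hs0 : 0 < s := hc₁.trans_le h₁
  have hT0 : 0 < (T : ℝ) := one_pos.trans_le (by exact_mod_cast hT)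
  rcases hr with hr | hr
  · rw [hlo _ ?_, zero_mul]
    rcases le_or_gt r 0 with hr0 | hr0
    · exact (mul_nonpos_of_nonpos_of_nonneg hr0 hs0.le).trans_lt (inv_pos.2 hT0)
    · calc r * s ≤ r * c₂ := mul_le_mul_of_nonneg_left h₂ hr0.le
        _ < (T : ℝ)⁻¹ / c₂ * c₂ := mul_lt_mul_of_pos_right hr hc₂
        _ = (T : ℝ)⁻¹ := div_mul_cancel₀ _ hc₂.ne'
  · rw [hhi _ ?_, zero_mul]
    have hr0 : 0 < r := (div_pos hT0 hc₁).trans hr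
    calc (T : ℝ) = (T : ℝ) / c₁ * c₁ := (div_mul_cancel₀ _ hc₁.ne').symm
      _ < r * c₁ := mul_lt_mul_of_pos_right hr hc₁
      _ ≤ r * s := mul_le_mul_of_nonneg_left h₁ hr0.le

/-- `(k ⋆ f)(r) = 0` for `r < T⁻¹∕c₂` and for `r > T∕c₁`. [folklore] -/
theorem mulConv_eq_zero (σ : Measure ℝ) {k : ℝ → ℂ} {f : ℝ → ℂ} {T : ℝ≥0} (hT : 1 ≤ T) (hhi : ∀ r : ℝ, (T : ℝ) < r → f r = 0)
    (hlo : ∀ r : ℝ, r < (T : ℝ)⁻¹ → f r = 0) {c₁ c₂ : ℝ} (hc₁ : 0 < c₁) (hc₁₂ : c₁ ≤ c₂) (hk : ∀ s : ℝ, k s ≠ 0 → c₁ ≤ s ∧ s ≤ c₂)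
    {r : ℝ} (hr : r < (T : ℝ)⁻¹ / c₂ ∨ (T : ℝ) / c₁ < r) : ∫ s, f (r * s) * k s ∂σ = 0 := by
  simp only [mulConv_integrand_eq_zero hT hhi hlo hc₁ hc₁₂ hk hr, integral_zero]

/-- **`k ⋆ f` HAS COMPACT SUPPORT** (`⊆ [T⁻¹∕c₂, T∕c₁]`). [cite: MoeglinWaldspurger1995, II.1.2] -/
theorem hasCompactSupport_mulConv (σ : Measure ℝ) {k : ℝ → ℂ} (hks : HasCompactSupport k) (hk0 : tsupport k ⊆ Ioi 0) {f : ℝ → ℂ} (hfs : HasCompactSupport f)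
    (hf0 : tsupport f ⊆ Ioi 0) : HasCompactSupport fun r : ℝ => ∫ s, f (r * s) * k s ∂σ := by
  obtain ⟨T, hT, hhi, hlo⟩ := exists_one_le_forall_eq_zero hfs hf0
  obtain ⟨c₁, c₂, hc₁, hc₁₂, hk⟩ := exists_bounds_of_tsupport_subset_Ioi hks hk0
  refine HasCompactSupport.intro (isCompact_Icc : IsCompact (Icc ((T : ℝ)⁻¹ / c₂) ((T : ℝ) / c₁))) fun r hr => ?_
  rw [mem_Icc, not_and_or, not_le, not_le] at hr
  exact mulConv_eq_zero σ hT hhi hlo hc₁ hc₁₂ hk hr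

/-- **`tsupport (k ⋆ f) ⊆ (0,∞)`**. [cite: MoeglinWaldspurger1995, II.1.2] -/
theorem tsupport_mulConv_subset_Ioi (σ : Measure ℝ) {k : ℝ → ℂ} (hks : HasCompactSupport k) (hk0 : tsupport k ⊆ Ioi 0) {f : ℝ → ℂ} (hfs : HasCompactSupport f)
    (hf0 : tsupport f ⊆ Ioi 0) : tsupport (fun r : ℝ => ∫ s, f (r * s) * k s ∂σ) ⊆ Ioi 0 := by
  obtain ⟨T, hT, hhi, hlo⟩ := exists_one_le_forall_eq_zero hfs hf0
  obtain ⟨c₁, c₂, hc₁, hc₁₂, hk⟩ := exists_bounds_of_tsupport_subset_Ioi hks hk0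
  have hT0 : 0 < (T : ℝ) := one_pos.trans_le (by exact_mod_cast hT)
  have hsub : Function.support (fun r : ℝ => ∫ s, f (r * s) * k s ∂σ) ⊆ Icc ((T : ℝ)⁻¹ / c₂) ((T : ℝ) / c₁) := by
    intro r hr
    by_contra hmem
    rw [mem_Icc, not_and_or, not_le, not_le] at hmem
    exact hr (mulConv_eq_zero σ hT hhi hlo hc₁ hc₁₂ hk hmem)
  exact (closure_minimal hsub isClosed_Icc).trans fun r hr => (div_pos (inv_pos.2 hT0) (hc₁.trans_le hc₁₂)).trans_le hr.1

/-- **`k ⋆ f` IS CONTINUOUS** (`f ∈ C_c`, `k ∈ C_c`, `σ` finite on compacta; dominated convergence with majorant `‖f‖_∞‖k‖`). [cite: MoeglinWaldspurger1995, II.1.2] -/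
theorem continuous_mulConv (σ : Measure ℝ) [IsFiniteMeasureOnCompacts σ] {k : ℝ → ℂ} (hk : Continuous k) (hks : HasCompactSupport k) {f : ℝ → ℂ}
    (hfc : Continuous f) (hfs : HasCompactSupport f) : Continuous fun r : ℝ => ∫ s, f (r * s) * k s ∂σ := by
  obtain ⟨Mf, hMf⟩ := hfc.bounded_above_of_compact_support hfs
  refine continuous_of_dominated (fun r => ((hfc.comp (continuous_const.mul continuous_id)).mul hk).aestronglyMeasurable)
    (fun r => Eventually.of_forall fun s => ?_) ((hk.norm.integrable_of_hasCompactSupport hks.norm).const_mul Mf)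
    (Eventually.of_forall fun s => ((hfc.comp (continuous_id.mul continuous_const)).mul continuous_const))
  rw [norm_mul]
  exact mul_le_mul_of_nonneg_right (hMf _) (norm_nonneg _)

/-- **`(d∕dr)(k ⋆ f) = (s·k) ⋆ f′`**: for `f ∈ C¹_c` and `k ∈ C_c((0,∞))`, `k ⋆ f` has derivative `∫ f′(r·s)·(s·k(s)) dσ(s)` (dominated differentiation, majorant `c₂‖f′‖_∞‖k‖`).
[cite: Folland1999, Thm. 2.27] -/
theorem hasDerivAt_mulConv (σ : Measure ℝ) [IsFiniteMeasureOnCompacts σ] {k : ℝ → ℂ} (hk : Continuous k) (hks : HasCompactSupport k) (hk0 : tsupport k ⊆ Ioi 0)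
    {f : ℝ → ℂ} (hf : ContDiff ℝ 1 f) (hfs : HasCompactSupport f) (r₀ : ℝ) :
    HasDerivAt (fun r : ℝ => ∫ s, f (r * s) * k s ∂σ) (∫ s, deriv f (r₀ * s) * (((s : ℝ) : ℂ) * k s) ∂σ) r₀ := by
  obtain ⟨c₁, c₂, hc₁, hc₁₂, hkb⟩ := exists_bounds_of_tsupport_subset_Ioi hks hk0
  have hfd : Differentiable ℝ f := hf.differentiable one_ne_zero
  have hf'c : Continuous (deriv f) := hf.continuous_deriv le_rfl
  obtain ⟨M', hM'⟩ := hf'c.bounded_above_of_compact_support hfs.deriv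
  have hM'0 : 0 ≤ M' := (norm_nonneg _).trans (hM' 0)
  have h := hasDerivAt_integral_of_dominated_loc_of_deriv_le (μ := σ) (x₀ := r₀) (s := univ) (bound := fun s => c₂ * M' * ‖k s‖)
    (F := fun r s => f (r * s) * k s) (F' := fun r s => deriv f (r * s) * (((s : ℝ) : ℂ) * k s)) univ_mem
    (Eventually.of_forall fun r => (hf.continuous.comp (continuous_const.mul continuous_id) |>.mul hk).aestronglyMeasurable)
    (((hf.continuous.comp (continuous_const.mul continuous_id)).mul hk).integrable_of_hasCompactSupport hks.mul_left)
    (((hf'c.comp (continuous_const.mul continuous_id)).mul (continuous_ofReal.mul hk)).aestronglyMeasurable)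
    (Eventually.of_forall fun s r _ => ?_) ((hk.norm.integrable_of_hasCompactSupport hks.norm).const_mul (c₂ * M'))
    (Eventually.of_forall fun s r _ => ?_)
  · exact h.2
  · -- the majorant
    by_cases hs : k s = 0
    · simp only [hs, mul_zero, norm_zero, le_refl]
    · obtain ⟨h1, h2⟩ := hkb s hs
      rw [norm_mul, norm_mul, Complex.norm_real, Real.norm_of_nonneg (hc₁.le.trans h1)]
      calc ‖deriv f (r * s)‖ * (s * ‖k s‖) ≤ M' * (c₂ * ‖k s‖) :=
            mul_le_mul (hM' _) (mul_le_mul_of_nonneg_right h2 (norm_nonneg _)) (mul_nonneg (hc₁.le.trans h1) (norm_nonneg _)) hM'0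
        _ = c₂ * M' * ‖k s‖ := by ring
  · -- the pointwise derivative (chain rule)
    have h1 : HasDerivAt (fun r : ℝ => f (r * s)) (s • deriv f (r * s)) r := (hfd (r * s)).hasDerivAt.scomp r (hasDerivAt_mul_const s)
    exact (h1.mul_const (k s)).congr_deriv (by rw [Complex.real_smul]; ring)

/-- **`k ⋆ f ∈ C^n` WHEN `f ∈ C^n_c`** (`k ∈ C_c((0,∞))`, `σ` finite on compacta): induction on `n`, the derivative being `(s·k) ⋆ f′` (`tsupport (s·k) ⊆ tsupport k`).
[cite: Folland1999, Thm. 2.27] -/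
theorem contDiff_mulConv (σ : Measure ℝ) [IsFiniteMeasureOnCompacts σ] {k : ℝ → ℂ} (hk : Continuous k) (hks : HasCompactSupport k) (hk0 : tsupport k ⊆ Ioi 0) {f : ℝ → ℂ}
    {n : ℕ} (hf : ContDiff ℝ n f) (hfs : HasCompactSupport f) : ContDiff ℝ n (fun r : ℝ => ∫ s, f (r * s) * k s ∂σ) := by
  induction n generalizing k f with
  | zero => exact contDiff_zero.2 (continuous_mulConv σ hk hks hf.continuous hfs)
  | succ n ih =>
    push_cast at hf ⊢
    have hf1 : ContDiff ℝ 1 f := hf.of_le (by exact_mod_cast Nat.le_add_left 1 n)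
    have hderiv : deriv (fun r : ℝ => ∫ s, f (r * s) * k s ∂σ) = fun r => ∫ s, deriv f (r * s) * (((s : ℝ) : ℂ) * k s) ∂σ :=
      funext fun r => (hasDerivAt_mulConv σ hk hks hk0 hf1 hfs r).deriv
    refine contDiff_succ_iff_deriv.2 ⟨fun r => (hasDerivAt_mulConv σ hk hks hk0 hf1 hfs r).differentiableAt, fun hω => absurd hω (WithTop.natCast_ne_top n), ?_⟩
    rw [hderiv]
    have hk0' : tsupport (fun s : ℝ => ((s : ℝ) : ℂ) * k s) ⊆ Ioi 0 :=
      (tsupport_mul_subset_right : tsupport ((fun s : ℝ => ((s : ℝ) : ℂ)) * k) ⊆ tsupport k).trans hk0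
    exact ih (continuous_ofReal.mul hk) hks.mul_left hk0' (contDiff_succ_iff_deriv.1 hf).2.2 hfs.deriv

/-- **THE MELLIN MULTIPLIER OF `k ⋆ f`.**  For `k, f ∈ C_c((0,∞))`, `σ` finite on compacta and s-finite, and every `w : ℂ`:
`mellin (k ⋆ f) w = (∫ k(s)·s^{−w} dσ(s))·mellin f w` (`= k̂(−w)·mellin f w`, `k̂(z) = ∫ k·s^{z} dσ`): Fubini on `(0,∞) × ℝ` (the integrand vanishes off `[T⁻¹∕c₂, T∕c₁] × [c₁, c₂]`, majorant
`(‖r^{w−1}‖·𝟙·‖f‖_∞)·‖k(s)‖`), then Mathlib `mellin_comp_mul_right` at `a = s > 0`. [cite: Titchmarsh1948, §1.29] [cite: MoeglinWaldspurger1995, II.1.3–II.1.4] -/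
theorem mellin_mulConv (σ : Measure ℝ) [IsFiniteMeasureOnCompacts σ] [SFinite σ] {k : ℝ → ℂ} (hk : Continuous k) (hks : HasCompactSupport k) (hk0 : tsupport k ⊆ Ioi 0)
    {f : ℝ → ℂ} (hfc : Continuous f) (hfs : HasCompactSupport f) (hf0 : tsupport f ⊆ Ioi 0) (w : ℂ) :
    mellin (fun r : ℝ => ∫ s, f (r * s) * k s ∂σ) w = (∫ s, k s * (((s : ℝ) : ℂ) ^ (-w)) ∂σ) * mellin f w := by
  obtain ⟨T, hT, hhi, hlo⟩ := exists_one_le_forall_eq_zero hfs hf0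
  obtain ⟨c₁, c₂, hc₁, hc₁₂, hkb⟩ := exists_bounds_of_tsupport_subset_Ioi hks hk0
  obtain ⟨Mf, hMf⟩ := hfc.bounded_above_of_compact_support hfs
  have hMf0 : 0 ≤ Mf := (norm_nonneg _).trans (hMf 0)
  have hT0 : 0 < (T : ℝ) := one_pos.trans_le (by exact_mod_cast hT)
  have ha : 0 < (T : ℝ)⁻¹ / c₂ := div_pos (inv_pos.2 hT0) (hc₁.trans_le hc₁₂)
  -- the uncurried integrand on `(0,∞) × ℝ`
  set Fn : ℝ → ℝ → ℂ := fun r s => ((r : ℂ) ^ (w - 1)) * (f (r * s) * k s) with hFn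
  have hmeas : AEStronglyMeasurable (Function.uncurry Fn) ((volume.restrict (Ioi (0 : ℝ))).prod σ) := by
    have h1 : AEStronglyMeasurable (fun p : ℝ × ℝ => ((p.1 : ℂ) ^ (w - 1))) ((volume.restrict (Ioi (0 : ℝ))).prod σ) :=
      (ContinuousOn.aestronglyMeasurable (fun r hr => (continuousAt_ofReal_cpow_const r (w - 1) (Or.inr (ne_of_gt hr))).continuousWithinAt)
        measurableSet_Ioi).comp_fst
    have h2 : Continuous fun p : ℝ × ℝ => f (p.1 * p.2) * k p.2 := (hfc.comp (continuous_fst.mul continuous_snd)).mul (hk.comp continuous_snd)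
    exact h1.mul h2.aestronglyMeasurable
  have hbound : ∀ r s : ℝ, ‖Fn r s‖ ≤ (‖((r : ℂ) ^ (w - 1))‖ * (Icc ((T : ℝ)⁻¹ / c₂) ((T : ℝ) / c₁)).indicator (fun _ => Mf) r) * ‖k s‖ := by
    intro r s
    by_cases hr : r ∈ Icc ((T : ℝ)⁻¹ / c₂) ((T : ℝ) / c₁)
    · rw [indicator_of_mem hr, hFn, norm_mul, norm_mul, mul_assoc]
      exact mul_le_mul_of_nonneg_left (mul_le_mul_of_nonneg_right (hMf _) (norm_nonneg _)) (norm_nonneg _)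
    · have hz := mulConv_integrand_eq_zero hT hhi hlo hc₁ hc₁₂ hkb (by rwa [mem_Icc, not_and_or, not_le, not_le] at hr) s
      rw [hFn]
      dsimp only
      rw [hz, mul_zero, norm_zero]
      exact mul_nonneg (mul_nonneg (norm_nonneg _) (indicator_nonneg (fun _ _ => hMf0) _)) (norm_nonneg _)
  have hint_r : Integrable (fun r : ℝ => ‖((r : ℂ) ^ (w - 1))‖ * (Icc ((T : ℝ)⁻¹ / c₂) ((T : ℝ) / c₁)).indicator (fun _ => Mf) r) (volume.restrict (Ioi (0 : ℝ))) := by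
    have heq : (fun r : ℝ => ‖((r : ℂ) ^ (w - 1))‖ * (Icc ((T : ℝ)⁻¹ / c₂) ((T : ℝ) / c₁)).indicator (fun _ => Mf) r) =
        (Icc ((T : ℝ)⁻¹ / c₂) ((T : ℝ) / c₁)).indicator (fun r => ‖((r : ℂ) ^ (w - 1))‖ * Mf) := by
      funext r
      by_cases hr : r ∈ Icc ((T : ℝ)⁻¹ / c₂) ((T : ℝ) / c₁)
      · rw [indicator_of_mem hr, indicator_of_mem hr]
      · rw [indicator_of_notMem hr, indicator_of_notMem hr, mul_zero]
    rw [heq, integrable_indicator_iff measurableSet_Icc]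
    have hcont : ContinuousOn (fun r : ℝ => ‖((r : ℂ) ^ (w - 1))‖ * Mf) (Icc ((T : ℝ)⁻¹ / c₂) ((T : ℝ) / c₁)) := fun r hr =>
      (((continuousAt_ofReal_cpow_const r (w - 1) (Or.inr (ha.trans_le hr.1).ne')).norm.mul continuousAt_const).continuousWithinAt)
    exact hcont.integrableOn_Icc.mono_measure restrict_le_self
  have hint : Integrable (Function.uncurry Fn) ((volume.restrict (Ioi (0 : ℝ))).prod σ) :=
    (hint_r.mul_prod (hk.norm.integrable_of_hasCompactSupport hks.norm)).mono' hmeas (Eventually.of_forall fun p => hbound p.1 p.2)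
  -- Fubini and the substitution `r ↦ r∕s`
  have hstep1 : mellin (fun r : ℝ => ∫ s, f (r * s) * k s ∂σ) w = ∫ r in Ioi (0 : ℝ), ∫ s, Fn r s ∂σ := by
    rw [mellin]
    refine setIntegral_congr_fun measurableSet_Ioi fun r _ => ?_
    rw [hFn, smul_eq_mul, ← integral_const_mul]
  have hstep2 : ∀ s : ℝ, ∫ r in Ioi (0 : ℝ), Fn r s = k s * ((((s : ℝ)) : ℂ) ^ (-w)) * mellin f w := by
    intro s
    by_cases hs : k s = 0
    · have h0 : (fun r : ℝ => Fn r s) = fun _ => 0 := by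
        funext r
        rw [hFn]
        dsimp only
        rw [hs, mul_zero, mul_zero]
      rw [h0, integral_zero, hs, zero_mul, zero_mul]
    · have hs0 : 0 < s := hc₁.trans_le (hkb s hs).1
      have heq : (fun r : ℝ => Fn r s) = fun r : ℝ => k s * (((r : ℂ) ^ (w - 1)) • f (r * s)) := by
        funext r
        rw [hFn, smul_eq_mul]
        ring
      rw [heq, integral_const_mul]
      change k s * mellin (fun r : ℝ => f (r * s)) w = _
      rw [mellin_comp_mul_right f w hs0, smul_eq_mul, mul_assoc]
  rw [hstep1, integral_integral_swap hint]
  simp_rw [hstep2]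
  rw [integral_mul_const]

/-- **GROUP SIDE = RADIAL SIDE UNDER A TORUS LETTER**: if `H(g·a_s) = H(g)·s` for `s > 0` and `k` lives on `(0,∞)`, the torus convolution of a radial `Φ = f∘H` is the radial function
`(k ⋆ f)∘H`: `∫ k(s)·f(H(y·a_s)) dσ(s) = ∫ f(H(y)·s)·k(s) dσ(s)`. [cite: MoeglinWaldspurger1995, II.1.2] -/
theorem torusConv_comp_eq {G : Type*} [Mul G] (σ : Measure ℝ) {Hf : G → ℝ} {a : ℝ → G} (hH : ∀ s : ℝ, 0 < s → ∀ g : G, Hf (g * a s) = Hf g * s)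
    {k : ℝ → ℂ} (hk0 : ∀ s : ℝ, k s ≠ 0 → 0 < s) (f : ℝ → ℂ) (y : G) :
    ∫ s, k s * f (Hf (y * a s)) ∂σ = ∫ s, f (Hf y * s) * k s ∂σ := by
  refine integral_congr_ae (Eventually.of_forall fun s => ?_)
  show k s * f (Hf (y * a s)) = f (Hf y * s) * k s
  by_cases hs : k s = 0
  · simp only [hs, zero_mul, mul_zero]
  · rw [hH s (hk0 s hs) y, mul_comm]

end Radial

/-! ## §3 The Weyl-symmetric class and the axis model identity `U_{k⋆f} = k̂(½+it)·U_f` -/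

section Axis

/-- **THE WEYL-SYMMETRIC CLASS (for `σ = d×s`, `k̂ = mellin k`)**: if `k(s⁻¹) = s·k(s)` for `s > 0` (e.g. `k(s) = s^{−1/2}κ(log s)` with `κ` even), then `mellin k z = mellin k (1 − z)` for every `z`
(Mathlib `mellin_comp_inv`: `mellin (k∘inv) z = mellin k (−z)`, and `k∘inv = s¹•k` on `(0,∞)`, `mellin_cpow_smul`). [cite: MoeglinWaldspurger1995, II.2.4] [cite: Titchmarsh1948, §1.29] -/
theorem mellin_eq_mellin_one_sub {k : ℝ → ℂ} (hW : ∀ s : ℝ, 0 < s → k s⁻¹ = ((s : ℝ) : ℂ) * k s) (z : ℂ) : mellin k z = mellin k (1 - z) := by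
  have h1 : mellin (fun s : ℝ => k s⁻¹) (-z) = mellin k z := by rw [mellin_comp_inv, neg_neg]
  have h2 : mellin (fun s : ℝ => k s⁻¹) (-z) = mellin (fun s : ℝ => ((s : ℂ) ^ (1 : ℂ)) • k s) (-z) := by
    refine setIntegral_congr_fun measurableSet_Ioi fun s hs => ?_
    simp only [hW s hs, cpow_one, smul_eq_mul]
  rw [← h1, h2, mellin_cpow_smul]
  ring_nf

/-- **THE AXIS MODEL IDENTITY `U_{k⋆f}(t) = k̂(½+it)·U_f(t)` UNDER WEYL SYMMETRY.**  For `k, f ∈ C_c((0,∞))`, `σ` finite on compacta and s-finite, ANY scalar `cI : ℂ → ℂ`, and the Weyl symmetry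
of the `σ`-multiplier on the unitary axis (hypothesis `hW`: `∫ k·s^{½−it} dσ = ∫ k·s^{½+it} dσ`; for `σ = d×s` it is `mellin_eq_mellin_one_sub`), in the bytes of ★ P2's model vector
`U_f(t) = mellin f (−(½+it)) + cI(½−it)·mellin f (−(½−it))`: `U_{k⋆f}(t) = (∫ k(s)·s^{½+it} dσ(s))·U_f(t)`.  WITHOUT `hW` the identity is false in general (the `cI`-term carries
`k̂(½−it)`), which is why ROADCARD §3′.1 (i) restricts the device to the Weyl-symmetric class (ruling (213)). [cite: MoeglinWaldspurger1995, II.2.4] [cite: Langlands1976, §6] -/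
theorem axisModel_mulConv_eq_mul (σ : Measure ℝ) [IsFiniteMeasureOnCompacts σ] [SFinite σ] {k : ℝ → ℂ} (hk : Continuous k) (hks : HasCompactSupport k) (hk0 : tsupport k ⊆ Ioi 0)
    {f : ℝ → ℂ} (hfc : Continuous f) (hfs : HasCompactSupport f) (hf0 : tsupport f ⊆ Ioi 0) (cI : ℂ → ℂ)
    (hW : ∀ t : ℝ, ∫ s, k s * (((s : ℝ) : ℂ) ^ ((((1 / 2 : ℝ)) : ℂ) + ((-t : ℝ) : ℂ) * I)) ∂σ = ∫ s, k s * (((s : ℝ) : ℂ) ^ ((((1 / 2 : ℝ)) : ℂ) + t * I)) ∂σ) (t : ℝ) :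
    mellin (fun r : ℝ => ∫ s, f (r * s) * k s ∂σ) (-((((1 / 2 : ℝ)) : ℂ) + t * I)) +
        cI ((((1 / 2 : ℝ)) : ℂ) + ((-t : ℝ) : ℂ) * I) * mellin (fun r : ℝ => ∫ s, f (r * s) * k s ∂σ) (-((((1 / 2 : ℝ)) : ℂ) + ((-t : ℝ) : ℂ) * I)) =
      (∫ s, k s * (((s : ℝ) : ℂ) ^ ((((1 / 2 : ℝ)) : ℂ) + t * I)) ∂σ) *
        (mellin f (-((((1 / 2 : ℝ)) : ℂ) + t * I)) + cI ((((1 / 2 : ℝ)) : ℂ) + ((-t : ℝ) : ℂ) * I) * mellin f (-((((1 / 2 : ℝ)) : ℂ) + ((-t : ℝ) : ℂ) * I))) := by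
  rw [mellin_mulConv σ hk hks hk0 hfc hfs hf0, mellin_mulConv σ hk hks hk0 hfc hfs hf0, neg_neg, neg_neg, hW t]
  ring

end Axis

end Summit.HodgeConjecture.HodgeConjecture.Cruxes.H413.K2E1TorusConvolutionCommuteU

end
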